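import Mathlib
import Summits.Ventures.HodgeRepro2.T7SupportTwoTorusMatrix

/-!
# Tier7/Line3/RegularDoubleCosets — THE SET OF REGULAR DOUBLE COSETS `T_A \ U(W) / T_B` AS A TYPE, with `κ` injective
on it (seat t7-x1, gen 2; the dictionary clause «`Orb` IS the regular double cosets» of the typed residual, crit-2
l. 15282 record (2), typed)

`KappaData` / `AdaptedData` take an abstract type `Orb` of double cosets with `κ` INJECTIVE — in words: `Orb` is the
set of REGULAR double cosets `T_A(F) \ U(W_A)(F) / T_B(F)` (p1's rows 662/663: `κ` separates the regular classes).
This module builds that set in p1's coordinates (`T7SupportTwoTorusInvariant` / `T7SupportTwoTorusMatrix`, any field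
`E` with a ring involution `σ`): the first torus `T_A` = the diagonal matrices `diagonal a` with `N(a i) = 1`, the
second torus `T_B` = the matrices `tB f b = P · diagonal b · P⁻¹` (`P = basisMat f`, `N(b j) = 1`) acting on the
second basis by the scalars `b`;
* `DC γ γ′ := ∃ a b, N(a i) = 1 ∧ N(b j) = 1 ∧ γ′ = diagonal a · γ · tB f b` is an equivalence relation
  (`dcSetoid`; `tB_mul`, `tB_one`, the norm-one scalars form a group);
* `κQ` = p1's invariant `kappa σ d f` descended to the quotient (`kappa_diag_mul`: constant on double cosets);
* **`RegOrb`** = the classes of a regular isometry (`IsIsom σ d γ`, `κ γ ∉ {0, 1}`), with the chosen representative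
  `matO : RegOrb → Matrix` (an isometry, `isIsom_matO`) and the invariant `κReg : RegOrb → E` (`kappa_matO`);
* **`κReg_injective`**: on `RegOrb` the invariant is injective — two regular isometries with the same invariant lie in
  one double coset (p1's `exists_double_coset_matrix_of_kappa_eq`, whose `t′` is `tB f b` by `eq_of_mulVec_basis`);
* `injective_of_descent`: a descent `κF : RegOrb → K` with `algebraMap K E (κF c) = κReg c` is injective — the field
  `hκ` of `AdaptedData` / `KappaData` for `Orb := RegOrb`.
Pure algebra over a field with an involution; nothing here is about an adelic group, a test function or a period;
nothing about (N) or HC_CM; §8(d): NO. Blind lane: Mathlib + the HodgeRepro2 prefix only; no sorry;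
axioms ⊆ {propext, Classical.choice, Quot.sound}.
-/

namespace Summit.Ventures.HodgeRepro2.Tier7.Line3.RegularDoubleCosets

open Matrix Summit.Ventures.HodgeRepro2.T7SupportTwoTorusInvariant
  Summit.Ventures.HodgeRepro2.T7SupportTwoTorusMatrix

variable {E : Type*} [Field E] (σ : E →+* E) (f : Fin 2 → Fin 2 → E)

/-! ## 1. The second torus and the double-coset relation -/

/-- `diagonal 1 = 1` for the constant-one function -/
theorem diagonal_pi_one : diagonal (1 : Fin 2 → E) = (1 : Matrix (Fin 2) (Fin 2) E) := diagonal_one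

/-- `diagonal b * diagonal b′ = diagonal (b * b′)` -/
theorem diagonal_pi_mul (b b' : Fin 2 → E) : diagonal b * diagonal b' = diagonal (b * b') :=
  diagonal_mul_diagonal b b'

/-- the element of the second torus acting on the basis `f` by the scalars `b`: `P · diagonal b · P⁻¹` -/
noncomputable def tB (b : Fin 2 → E) : Matrix (Fin 2) (Fin 2) E := basisMat f * diagonal b * (basisMat f)⁻¹

/-- `tB f b` acts on the second basis by `b` -/
theorem actsOn_tB (hP : IsUnit (basisMat f).det) (b : Fin 2 → E) : ActsOn f (tB f b) b :=
  actsOn_conj_diagonal f hP b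

/-- `tB f 1 = 1` -/
theorem tB_one (hP : IsUnit (basisMat f).det) : tB f 1 = 1 := by
  unfold tB
  rw [diagonal_pi_one, Matrix.mul_one, mul_nonsing_inv _ hP]

/-- `tB` is multiplicative -/
theorem tB_mul (hP : IsUnit (basisMat f).det) (b b' : Fin 2 → E) : tB f b * tB f b' = tB f (b * b') := by
  unfold tB
  rw [← diagonal_pi_mul]
  simp only [Matrix.mul_assoc]
  rw [← Matrix.mul_assoc (basisMat f)⁻¹ (basisMat f), nonsing_inv_mul _ hP, Matrix.one_mul]

/-- the matrix `tB f b` acting on the basis `f` by `b` is the ONLY matrix acting so -/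
theorem eq_tB_of_actsOn (hP : IsUnit (basisMat f).det) (t' : Matrix (Fin 2) (Fin 2) E) (b : Fin 2 → E)
    (h : ActsOn f t' b) : t' = tB f b :=
  eq_of_mulVec_basis f hP t' (tB f b) fun j => by rw [h j, actsOn_tB f hP b j]

/-- the norm-one elements are non-zero -/
theorem ne_zero_of_nrm_eq_one {x : E} (h : nrm σ x = 1) : x ≠ 0 := by
  intro hx
  rw [hx] at h
  simp [nrm] at h

/-- the inverse of a norm-one element has norm one -/
theorem nrm_inv_eq_one {x : E} (h : nrm σ x = 1) : nrm σ x⁻¹ = 1 := by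
  rw [← one_div, nrm_div, nrm_one, h, div_one]

/-- **the double-coset relation**: `γ′ = diagonal a · γ · tB f b` with `a`, `b` of norm one -/
def DC (γ γ' : Matrix (Fin 2) (Fin 2) E) : Prop :=
  ∃ a b : Fin 2 → E, (∀ i, nrm σ (a i) = 1) ∧ (∀ j, nrm σ (b j) = 1) ∧ γ' = diagonal a * γ * tB f b

/-- reflexivity -/
theorem dc_refl (hP : IsUnit (basisMat f).det) (γ : Matrix (Fin 2) (Fin 2) E) : DC σ f γ γ :=
  ⟨1, 1, fun _ => nrm_one σ, fun _ => nrm_one σ, by rw [tB_one f hP, diagonal_pi_one, Matrix.one_mul, Matrix.mul_one]⟩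

/-- symmetry -/
theorem dc_symm (hP : IsUnit (basisMat f).det) {γ γ' : Matrix (Fin 2) (Fin 2) E} (h : DC σ f γ γ') :
    DC σ f γ' γ := by
  obtain ⟨a, b, ha, hb, rfl⟩ := h
  refine ⟨fun i => (a i)⁻¹, fun j => (b j)⁻¹, fun i => nrm_inv_eq_one σ (ha i), fun j => nrm_inv_eq_one σ (hb j), ?_⟩
  have hb1 : b * (fun j => (b j)⁻¹) = (1 : Fin 2 → E) := by
    funext j
    exact mul_inv_cancel₀ (ne_zero_of_nrm_eq_one σ (hb j))
  have ha1 : diagonal (fun i => (a i)⁻¹) * diagonal a = 1 := by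
    rw [diagonal_mul_diagonal, ← diagonal_one]
    congr 1
    funext i
    exact inv_mul_cancel₀ (ne_zero_of_nrm_eq_one σ (ha i))
  symm
  calc diagonal (fun i => (a i)⁻¹) * (diagonal a * γ * tB f b) * tB f (fun j => (b j)⁻¹)
      = (diagonal (fun i => (a i)⁻¹) * diagonal a) * γ * (tB f b * tB f (fun j => (b j)⁻¹)) := by
        simp only [Matrix.mul_assoc]
    _ = 1 * γ * 1 := by rw [ha1, tB_mul f hP, hb1, tB_one f hP]
    _ = γ := by rw [Matrix.one_mul, Matrix.mul_one]

/-- transitivity -/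
theorem dc_trans (hP : IsUnit (basisMat f).det) {γ γ' γ'' : Matrix (Fin 2) (Fin 2) E} (h : DC σ f γ γ')
    (h' : DC σ f γ' γ'') : DC σ f γ γ'' := by
  obtain ⟨a, b, ha, hb, rfl⟩ := h
  obtain ⟨a', b', ha', hb', rfl⟩ := h'
  refine ⟨a' * a, b * b', fun i => by rw [Pi.mul_apply, nrm_mul, ha' i, ha i, one_mul],
    fun j => by rw [Pi.mul_apply, nrm_mul, hb j, hb' j, one_mul], ?_⟩
  rw [← tB_mul f hP, ← diagonal_pi_mul]
  simp only [Matrix.mul_assoc]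

/-- the double cosets as a setoid on the matrices -/
def dcSetoid (hP : IsUnit (basisMat f).det) : Setoid (Matrix (Fin 2) (Fin 2) E) where
  r := DC σ f
  iseqv := ⟨dc_refl σ f hP, dc_symm σ f hP, dc_trans σ f hP⟩

/-! ## 2. The invariant on the quotient -/

variable (d : Fin 2 → E)

/-- `κ` is constant on double cosets -/
theorem kappa_eq_of_dc (hP : IsUnit (basisMat f).det) {γ γ' : Matrix (Fin 2) (Fin 2) E} (h : DC σ f γ γ') :
    kappa σ d f γ = kappa σ d f γ' := by
  obtain ⟨a, b, ha, hb, rfl⟩ := h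
  exact (kappa_diag_mul σ d f γ (tB f b) a b (ha 0) (hb 0) (actsOn_tB f hP b)).symm

/-- the invariant on the quotient -/
noncomputable def κQ (hP : IsUnit (basisMat f).det) : Quotient (dcSetoid σ f hP) → E :=
  Quotient.lift (kappa σ d f) fun _ _ h => kappa_eq_of_dc σ f d hP h

/-- `κQ` on a class is `κ` of a representative -/
theorem κQ_mk (hP : IsUnit (basisMat f).det) (γ : Matrix (Fin 2) (Fin 2) E) :
    κQ σ f d hP (Quotient.mk (dcSetoid σ f hP) γ) = kappa σ d f γ := rfl

/-- a regular isometry: an isometry of the form with invariant `∉ {0, 1}` -/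
def IsRegIsom (γ : Matrix (Fin 2) (Fin 2) E) : Prop :=
  IsIsom σ d γ ∧ kappa σ d f γ ≠ 0 ∧ kappa σ d f γ ≠ 1

/-- **THE REGULAR DOUBLE COSETS**: the classes containing a regular isometry -/
def RegOrb (hP : IsUnit (basisMat f).det) : Type _ :=
  {c : Quotient (dcSetoid σ f hP) // ∃ γ, Quotient.mk (dcSetoid σ f hP) γ = c ∧ IsRegIsom σ f d γ}

/-- the chosen regular isometry representing a regular double coset -/
noncomputable def matO (hP : IsUnit (basisMat f).det) (c : RegOrb σ f d hP) : Matrix (Fin 2) (Fin 2) E :=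
  Classical.choose c.2

/-- the representative represents -/
theorem mk_matO (hP : IsUnit (basisMat f).det) (c : RegOrb σ f d hP) :
    Quotient.mk (dcSetoid σ f hP) (matO σ f d hP c) = c.1 :=
  (Classical.choose_spec c.2).1

/-- the representative is a regular isometry -/
theorem isRegIsom_matO (hP : IsUnit (basisMat f).det) (c : RegOrb σ f d hP) : IsRegIsom σ f d (matO σ f d hP c) :=
  (Classical.choose_spec c.2).2

/-- the representative is an isometry (the field `hiso` of `AdaptedData`) -/
theorem isIsom_matO (hP : IsUnit (basisMat f).det) (c : RegOrb σ f d hP) : IsIsom σ d (matO σ f d hP c) :=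
  (isRegIsom_matO σ f d hP c).1

/-- the invariant of a regular double coset -/
noncomputable def κReg (hP : IsUnit (basisMat f).det) (c : RegOrb σ f d hP) : E := κQ σ f d hP c.1

/-- the invariant of the class is the invariant of its representative -/
theorem kappa_matO (hP : IsUnit (basisMat f).det) (c : RegOrb σ f d hP) :
    kappa σ d f (matO σ f d hP c) = κReg σ f d hP c := by
  unfold κReg
  rw [← mk_matO σ f d hP c, κQ_mk]

/-! ## 3. Injectivity of the invariant on the regular double cosets -/

/-- **`κ` separates the regular double cosets** (p1's `exists_double_coset_matrix_of_kappa_eq` + `eq_tB_of_actsOn`):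
two regular double cosets with the same invariant are equal. -/
theorem κReg_injective (hσ : ∀ x, σ (σ x) = x) (hd : ∀ i, σ (d i) = d i) (hd0 : ∀ i, d i ≠ 0)
    (hP : IsUnit (basisMat f).det) (hf : herm σ d (f 0) (f 1) = 0) (hf0 : disc' σ d f 0 ≠ 0)
    (hf1 : disc' σ d f 1 ≠ 0) : Function.Injective (κReg σ f d hP) := by
  intro c c' h
  have hc := isRegIsom_matO σ f d hP c
  have hc' := isRegIsom_matO σ f d hP c'
  have hκ : kappa σ d f (matO σ f d hP c') = kappa σ d f (matO σ f d hP c) := by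
    rw [kappa_matO, kappa_matO, h]
  obtain ⟨a, b, t', ha, hb, hact, heq⟩ := exists_double_coset_matrix_of_kappa_eq σ hσ d hd hd0 f hP hf hf0 hf1
    (matO σ f d hP c) (matO σ f d hP c') hc.1 hc'.1 hκ hc.2.1 hc.2.2
  have hdc : DC σ f (matO σ f d hP c) (matO σ f d hP c') :=
    ⟨a, b, ha, hb, by rw [heq, eq_tB_of_actsOn f hP t' b hact]⟩
  apply Subtype.ext
  rw [← mk_matO σ f d hP c, ← mk_matO σ f d hP c']
  exact Quotient.sound hdc

/-- **the field `hκ`**: a descent `κF : RegOrb → K` of the invariant to a subfield is injective. -/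
theorem injective_of_descent {K : Type*} [Field K] [Algebra K E] (hσ : ∀ x, σ (σ x) = x)
    (hd : ∀ i, σ (d i) = d i) (hd0 : ∀ i, d i ≠ 0) (hP : IsUnit (basisMat f).det)
    (hf : herm σ d (f 0) (f 1) = 0) (hf0 : disc' σ d f 0 ≠ 0) (hf1 : disc' σ d f 1 ≠ 0)
    (κF : RegOrb σ f d hP → K) (hκF : ∀ c, algebraMap K E (κF c) = κReg σ f d hP c) :
    Function.Injective κF := by
  intro c c' h
  apply κReg_injective σ f d hσ hd hd0 hP hf hf0 hf1
  rw [← hκF, ← hκF, h]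

/-- the descent identity in the shape of `AdaptedData.hκF`: `algebraMap K E (κF c) = kappa σ d f (matO c)` -/
theorem descent_matO {K : Type*} [Field K] [Algebra K E] (hP : IsUnit (basisMat f).det)
    (κF : RegOrb σ f d hP → K) (hκF : ∀ c, algebraMap K E (κF c) = κReg σ f d hP c) (c : RegOrb σ f d hP) :
    algebraMap K E (κF c) = kappa σ d f (matO σ f d hP c) := by
  rw [hκF, kappa_matO]

end Summit.Ventures.HodgeRepro2.Tier7.Line3.RegularDoubleCosets
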